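import Mathlib
import Literature.Computability.AlgebraicComplexity.HessianAtOrigin
import Literature.Computability.AlgebraicComplexity.MignonRessayreBound
import Summits.ValiantsHypothesis.ValiantsHypothesis.Theorems.GrenetZeonTwoDimCoefficientsUnitCase
import Summits.ValiantsHypothesis.ValiantsHypothesis.Theorems.GrenetZeonTwoDimCoefficientsScalingClosureReduction

/-!
# Crux `GrenetZeon.TwoDimCoefficients` (stmt-ValiantsHypothesis-8062), stub `stub_dualUnipotent`:
# scaling-closure — the two PERMANENT-SPECIFIC inputs of the torus step

The generic torus degeneration ✓ `torusClosure` needs, to be run on the shadow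
`Φ_per = c + β⁻¹·per_n + (companions)`, exactly two facts about the permanent:

* ★ `eval_torus_perPoly` / `eval_torus_perPoly_of_sum_eq_zero` — TORUS COVARIANCE:
  `per_n(d^{u_i+v_j}·z_{ij}) = d^{Σu+Σv}·per_n(z)`, hence invariance under every integral weight `(u, v)` with
  `Σ_i u_i + Σ_j v_j = 0` (the one-parameter subgroups of the stabiliser torus of `per_n`);
* ★ `sq_le_of_smoothZeroBound_perLevel` — the END OF THE LINE: if `rank Hess ≤ r` at every SMOOTH zero of
  `c + μ·per_n` (`c, μ ≠ 0`, `n ≥ 3`), then `n² ≤ r` (dilated Mignon–Ressayre-type point + Euler).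

Assembly (file `…ScalingTorusAssembly`): `exists_shadowFamily` ⟶ `rank_hess0_shadow_le` ⟶ ✓ `torusClosure` with
`Φ₀ = c + β⁻¹·per_n` (invariant by `eval_torus_perLevel_of_sum_eq_zero`) ⟶ `sq_le_of_smoothZeroBound_perLevel`.

HONEST FRAMING: two lemmas about `per_n`; the stub `DualUnipotentBound`, the crux and `VP ≠ VNP` remain open.

References: T. Mignon, N. Ressayre, Int. Math. Res. Not. 2004:79, Thm. 1.1 (the point; tree
`exists_eval_perPoly_ne_zero_and_isUnit_hess0`); M. Marcus, F. May, Illinois J. Math. 6 (1962) (the stabiliser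
of the permanent contains the torus `x_{ij} ↦ a_i b_j x_{ij}`, `Πa_iΠb_j = 1` — only this inclusion is used).
-/

-- single-conjunct layout `Summits/ValiantsHypothesis/ValiantsHypothesis`: the duplicated namespace
-- component is mandated by the tree.
set_option linter.dupNamespace false
set_option autoImplicit false

noncomputable section

namespace Summit.ValiantsHypothesis.ValiantsHypothesis.Theorems.GrenetZeonTwoDimCoefficients.ScalingClosure

open MvPolynomial Matrix
open Literature.Computability.AlgebraicComplexity
open Summit.ValiantsHypothesis.ValiantsHypothesis.Cruxes.TwoDimCoefficients.DimTwoCases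

/-! ### Torus covariance of the permanent -/

section Torus

/-- `Π_{i ∈ s} d^{f i} = d^{Σ_{i ∈ s} f i}` for integer exponents and `d ≠ 0`. [folklore] -/
theorem prod_zpow_eq_zpow_sum {ι : Type*} (s : Finset ι) (f : ι → ℤ) {d : ℂ} (hd : d ≠ 0) :
    ∏ i ∈ s, d ^ (f i) = d ^ (∑ i ∈ s, f i) := by
  classical
  induction s using Finset.induction_on with
  | empty => simp
  | insert a s ha ih => rw [Finset.prod_insert ha, Finset.sum_insert ha, ih, zpow_add₀ hd]

/-- ★ **Torus covariance of the permanent.**  For integral weights `u, v` and `d ≠ 0`,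
`per_n(d^{u_i + v_j}·z_{ij}) = d^{Σ_i u_i + Σ_j v_j}·per_n(z)`. [folklore] -/
theorem eval_torus_perPoly {n : ℕ} (u v : Fin n → ℤ) {d : ℂ} (hd : d ≠ 0) (z : Fin n × Fin n → ℂ) :
    eval (fun p : Fin n × Fin n => d ^ (u p.1 + v p.2) * z p) (perPoly (Fin n) ℂ) =
      d ^ (∑ i, u i + ∑ j, v j) * eval z (perPoly (Fin n) ℂ) := by
  rw [eval_perPoly, eval_perPoly]
  unfold Matrix.permanent
  rw [Finset.mul_sum]
  refine Finset.sum_congr rfl fun σ _ => ?_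
  simp only [Matrix.of_apply]
  rw [Finset.prod_mul_distrib, prod_zpow_eq_zpow_sum _ _ hd]
  congr 2
  rw [Finset.sum_add_distrib, Equiv.sum_comp σ u]

/-- Hence `per_n` is INVARIANT under every one-parameter subgroup of its stabiliser torus:
`Σu + Σv = 0 ⟹ per_n(d^{u_i+v_j}·z_{ij}) = per_n(z)`. [folklore] -/
theorem eval_torus_perPoly_of_sum_eq_zero {n : ℕ} (u v : Fin n → ℤ) (huv : ∑ i, u i + ∑ j, v j = 0)
    {d : ℂ} (hd : d ≠ 0) (z : Fin n × Fin n → ℂ) :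
    eval (fun p : Fin n × Fin n => d ^ (u p.1 + v p.2) * z p) (perPoly (Fin n) ℂ) =
      eval z (perPoly (Fin n) ℂ) := by
  rw [eval_torus_perPoly u v hd, huv, zpow_zero, one_mul]

/-- The same for the level polynomial `c + μ·per_n` (the invariant part `Φ₀` of the shadow). [folklore] -/
theorem eval_torus_perLevel_of_sum_eq_zero {n : ℕ} (c μ : ℂ) (u v : Fin n → ℤ)
    (huv : ∑ i, u i + ∑ j, v j = 0) {d : ℂ} (hd : d ≠ 0) (z : Fin n × Fin n → ℂ) :
    eval (fun p : Fin n × Fin n => d ^ (u p.1 + v p.2) * z p)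
        (MvPolynomial.C c + MvPolynomial.C μ * perPoly (Fin n) ℂ) =
      eval z (MvPolynomial.C c + MvPolynomial.C μ * perPoly (Fin n) ℂ) := by
  rw [map_add, map_mul, MvPolynomial.eval_C, MvPolynomial.eval_C,
    eval_torus_perPoly_of_sum_eq_zero u v huv hd, map_add, map_mul, MvPolynomial.eval_C,
    MvPolynomial.eval_C]

end Torus

/-! ### The end of the line: a smooth-zero Hessian bound for `c + μ·per_n` forces `n² ≤ r` -/

section Level

/-- ★ **End of the line.**  If `rank Hess(c + μ·per_n)(z) ≤ r` at every zero `z` of `c + μ·per_n` with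
`∇ ≠ 0` (`c, μ ≠ 0`, `n = k + 3`), then `n² ≤ r`: a dilate of the tree's point with invertible Hessian lies on
the level set, has non-zero gradient by Euler's identity and Hessian rank `n²`.
[cite: MignonRessayre2004, Thm. 1.1 — the point; folklore] -/
theorem sq_le_of_smoothZeroBound_perLevel {k r : ℕ} (c μ : ℂ) (hc : c ≠ 0) (hμ : μ ≠ 0)
    (h : ∀ z : Fin (k + 3) × Fin (k + 3) → ℂ,
      eval z (MvPolynomial.C c + MvPolynomial.C μ * perPoly (Fin (k + 3)) ℂ) = 0 →
      (∃ i, eval z (pderiv i (MvPolynomial.C c + MvPolynomial.C μ * perPoly (Fin (k + 3)) ℂ)) ≠ 0) →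
      (hess0 (transl z (MvPolynomial.C c + MvPolynomial.C μ * perPoly (Fin (k + 3)) ℂ))).rank ≤ r) :
    (k + 3) ^ 2 ≤ r := by
  classical
  obtain ⟨y, hy, hyU⟩ := exists_eval_perPoly_ne_zero_and_isUnit_hess0 k
  obtain ⟨s, hs⟩ := IsAlgClosed.exists_pow_nat_eq
    (-c / (μ * eval y (perPoly (Fin (k + 3)) ℂ))) (Nat.succ_pos (k + 2))
  have hsn : s ^ (k + 3) * (μ * eval y (perPoly (Fin (k + 3)) ℂ)) = -c := by
    rw [hs]
    field_simp
  have hs0 : s ≠ 0 := by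
    rintro rfl
    rw [zero_pow (Nat.succ_ne_zero _), zero_mul] at hsn
    exact hc (neg_eq_zero.mp hsn.symm)
  set z₀ : Fin (k + 3) × Fin (k + 3) → ℂ := s • y with hz₀
  have hper : eval z₀ (perPoly (Fin (k + 3)) ℂ) = s ^ (k + 3) * eval y (perPoly (Fin (k + 3)) ℂ) := by
    rw [hz₀, eval_smul_perPoly]
  have hzero : eval z₀ (MvPolynomial.C c + MvPolynomial.C μ * perPoly (Fin (k + 3)) ℂ) = 0 := by
    rw [map_add, map_mul, MvPolynomial.eval_C, MvPolynomial.eval_C, hper]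
    linear_combination hsn
  have hper0 : eval z₀ (perPoly (Fin (k + 3)) ℂ) ≠ 0 := by
    rw [hper]
    exact mul_ne_zero (pow_ne_zero _ hs0) hy
  have hhom : (perPoly (Fin (k + 3)) ℂ).IsHomogeneous (k + 3) := by
    simpa [Fintype.card_fin] using perPoly_isHomogeneous (n := Fin (k + 3)) (k := ℂ)
  obtain ⟨i, hi⟩ := exists_eval_pderiv_ne_zero_of_isHomogeneous _ hhom (Nat.succ_ne_zero _) z₀ hper0
  have hgrad : ∃ i, eval z₀ (pderiv i (MvPolynomial.C c + MvPolynomial.C μ *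
      perPoly (Fin (k + 3)) ℂ)) ≠ 0 := by
    refine ⟨i, ?_⟩
    rw [map_add, pderiv_C, zero_add, pderiv_C_mul, map_mul, MvPolynomial.eval_C]
    exact mul_ne_zero hμ hi
  have hT : hess0 (transl z₀ (MvPolynomial.C c + MvPolynomial.C μ * perPoly (Fin (k + 3)) ℂ)) =
      μ • hess0 (transl z₀ (perPoly (Fin (k + 3)) ℂ)) := by
    rw [map_add, map_mul, transl_C, transl_C, map_add, hess0_C_mul,
      hess0_eq_zero_of_totalDegree_le_one ((totalDegree_C c).le.trans zero_le_one), zero_add]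
  have hU : IsUnit (hess0 (transl z₀ (perPoly (Fin (k + 3)) ℂ))) := by
    rw [Matrix.isUnit_iff_isUnit_det, hz₀, hess0_transl_smul_perPoly, det_smul]
    exact (IsUnit.pow _ (isUnit_iff_ne_zero.mpr (pow_ne_zero _ hs0))).mul hyU
  have hrank := h z₀ hzero hgrad
  rw [hT, rank_smul_eq hμ, rank_of_isUnit _ hU, Fintype.card_prod, Fintype.card_fin] at hrank
  nlinarith [hrank]

end Level


end Summit.ValiantsHypothesis.ValiantsHypothesis.Theorems.GrenetZeonTwoDimCoefficients.ScalingClosure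

end
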